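import Summits.MatrixMultiplication.MatrixMultiplication.Theses.DefinableSTPPDichotomy
import Summits.MatrixMultiplication.MatrixMultiplication.Theorems.DefinableSTPPDichotomyHexagonClearanceRStubMassBound
import Summits.MatrixMultiplication.MatrixMultiplication.Theorems.DefinableSTPPDichotomyHexagonClearanceRStubShadowBound
import Summits.MatrixMultiplication.MatrixMultiplication.Theorems.DefinableSTPPDichotomyHexagonClearanceRStubNoLonelyOfAlg
import Summits.MatrixMultiplication.MatrixMultiplication.Theorems.DefinableSTPPDichotomyHexagonClearanceRStubNormalForm
import Summits.MatrixMultiplication.MatrixMultiplication.Theorems.DefinableSTPPDichotomyHexagonClearanceRStubRadical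
import Literature.ModelTheory.PseudofiniteFields.DefinableSetsFiniteFieldsDecomposition
import Summits.MatrixMultiplication.MatrixMultiplication.Theorems.DefinableSTPPDichotomyHexagonClearanceROfRecurrence

/-!
# `DefinableSTPPDichotomy.HexagonClearanceR` (stmt-MatrixMultiplication-17884) — assembly of line `Sketch`

The repaired seam `HexagonClearanceR` holds VACUOUSLY in large characteristic: no realised definable family
in `F^m` satisfying the ≥2-equal-label STPP patterns has mass `Σ_I (|A||B||C|)^{(2+ε)/3} ≥ |F|^{m+η}` for
`ε ≤ 1/(m+1)` once `|F|^η` exceeds a constant of the formulas.  Chain (all landed as `--supports` files):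

* `stub_massBound_of_shadowBound` — three packings + block TPP + three-term AM–GM;
* `stub_shadowBound_of_noLonely` — pattern `k = i` makes every translate `(b−c) − a₀ + A_x` lonely on the
  `B − C` shadow, impossible at a generic point ("no lonely generic point");
* `stub_noLonely_of_alg` — from the normal form of definable sets and the algebraic statement;
* `stub_normalForm_of_prop27` — CDM 1992 Prop. (2.7) (named fact, hypothesis `stub_prop27` below) gives the
  normal form `φ(w;y) ↔ ⋀_l ∃t G_l(w,t) = 0`;
* `stub_radicalNormalForm` — radicals: off a small exceptional set every rational root is simple;
* hypothesis `stub_persistence` — PERSISTENCE AT A SIMPLE ROOT, the algebraic-geometric core (étale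
  persistence along a geometrically irreducible curve in the lifted block; Lang–Weil), registered stub of the
  crux, open;
* this file: the one-variable dictionary (`Glue.*`) and the glue `noLonelyAlg`; the transfer
  `MassBoundLC → HexagonClearanceR` is `hexagonClearanceR_of_massBound` of the sibling file
  `DefinableSTPPDichotomyHexagonClearanceROfRecurrence` (`ε₀ := 1/(m+1)`, threshold after `η`).

So `HexagonClearanceR_of` proves the crux from exactly two registered hypotheses: `stub_persistence` and the
named fact `stub_prop27 : ChatzidakisVanDenDriesMacintyre1992_prop27`.
-/

set_option linter.dupNamespace false

namespace Summit.MatrixMultiplication.MatrixMultiplication.Theorems.HexagonClearanceR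

open Finset
open Summit.MatrixMultiplication.MatrixMultiplication.Theses.DefinableSTPPDichotomy
open Literature.ModelTheory.PseudofiniteFields

/-- Dictionary (last variable as the polynomial variable): `(t, w) ∘ finRotate = (w, t)`. -/
theorem Glue.cons_comp_finRotate {α : Type*} (m : ℕ) (w : Fin m → α) (t : α) :
    (Fin.cons t w : Fin (m + 1) → α) ∘ (finRotate (m + 1)) = Fin.snoc w t := by
  funext i
  simp only [Function.comp_apply]
  refine Fin.lastCases ?_ (fun j => ?_) i
  · simp
  · rw [Fin.snoc_castSucc]
    have : (finRotate (m + 1)) (Fin.castSucc j) = j.succ := by simp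
    rw [this, Fin.cons_succ]

/-- Dictionary: evaluating `p ∈ F[X_0, …, X_m]` at `(w, t)` is evaluating at `t` the specialisation at
`w` of the one-variable polynomial `toPoly p := finSuccEquiv (rename finRotate p)` over `F[X_0, …, X_{m-1}]`. -/
theorem Glue.eval_snoc_eq {F : Type*} [CommRing F] (m : ℕ) (p : MvPolynomial (Fin (m + 1)) F)
    (w : Fin m → F) (t : F) :
    MvPolynomial.eval (Fin.snoc w t : Fin (m + 1) → F) p =
      Polynomial.eval t (Polynomial.map (MvPolynomial.eval w)
        (MvPolynomial.finSuccEquiv F m (MvPolynomial.rename (finRotate (m + 1)) p))) := by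
  rw [← MvPolynomial.eval_eq_eval_mv_eval', MvPolynomial.eval_rename, Glue.cons_comp_finRotate]

/-- Dictionary: the `t`-degree of `toPoly p` is at most the total degree of `p`. -/
theorem Glue.natDegree_toPoly_le {F : Type*} [CommRing F] (m : ℕ) (p : MvPolynomial (Fin (m + 1)) F) :
    (MvPolynomial.finSuccEquiv F m (MvPolynomial.rename (finRotate (m + 1)) p)).natDegree ≤
      p.totalDegree := by
  rw [MvPolynomial.natDegree_finSuccEquiv]
  exact (MvPolynomial.degreeOf_le_totalDegree _ _).trans (MvPolynomial.totalDegree_rename_le _ _)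

/-- Dictionary: the coefficients of `toPoly p` have total degree at most that of `p`. -/
theorem Glue.totalDegree_coeff_toPoly_le {F : Type*} [CommRing F] (m : ℕ)
    (p : MvPolynomial (Fin (m + 1)) F) (k : ℕ) :
    ((MvPolynomial.finSuccEquiv F m (MvPolynomial.rename (finRotate (m + 1)) p)).coeff k).totalDegree ≤
      p.totalDegree := by
  by_cases h : (MvPolynomial.finSuccEquiv F m (MvPolynomial.rename (finRotate (m + 1)) p)).coeff k = 0
  · rw [h, MvPolynomial.totalDegree_zero]; exact Nat.zero_le _
  · exact le_trans (Nat.le_add_right _ _) ((MvPolynomial.totalDegree_coeff_finSuccEquiv_add_le _ k h).trans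
      (MvPolynomial.totalDegree_rename_le _ _))

/-- The algebraic "no lonely generic point" (in the `F[X_0..X_m]` / `Fin.snoc` typing of
`stub_noLonely_of_alg`) from the landed radical normal form (`stub_radicalNormalForm`) and the persistence
hypothesis (one-variable typing): pass to `toPoly`, replace `G` by its radicals `S`; outside the exceptional
set every rational root is simple, so persistence applies. -/
theorem noLonelyAlg
    (stub_persistence : (∀ (m L L' D : ℕ), ∃ (K Q : ℕ), ∀ (F : Type) [Field F] [Fintype F],
        Q ≤ ringChar F → ∀ (G : Fin L → Polynomial (MvPolynomial (Fin m) F)),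
          (∀ l, (G l).natDegree ≤ D ∧ ∀ k, ((G l).coeff k).totalDegree ≤ D) →
          ∀ (H : Fin L' → Polynomial (MvPolynomial (Fin m) F)),
          (∀ l, (H l).natDegree ≤ D ∧ ∀ k, ((H l).coeff k).totalDegree ≤ D) →
          ∀ (T A : Finset (Fin m → F)),
            (∀ w, w ∈ T ↔ ∀ l, ∃ t : F, Polynomial.eval t (Polynomial.map (MvPolynomial.eval w) (G l)) = 0) →
            (∀ v, v ∈ A ↔ ∀ l, ∃ t : F, Polynomial.eval t (Polynomial.map (MvPolynomial.eval v) (H l)) = 0) →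
            K < A.card → ∀ t₀ ∈ T,
              (∀ l, ∃ t : F, Polynomial.eval t (Polynomial.map (MvPolynomial.eval t₀) (G l)) = 0 ∧
                Polynomial.eval t (Polynomial.derivative (Polynomial.map (MvPolynomial.eval t₀) (G l))) ≠ 0) →
              ∃ a₀ ∈ A, ∃ a ∈ A, a ≠ a₀ ∧ t₀ + a - a₀ ∈ T)) :
    (∀ (m L L' D : ℕ), ∃ (K Q : ℕ) (C₀ : ℝ), ∀ (F : Type) [Field F] [Fintype F],
        Q ≤ ringChar F → ∀ (G : Fin L → MvPolynomial (Fin (m + 1)) F),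
          (∀ l, (G l).totalDegree ≤ D) → ∃ E : Finset (Fin m → F),
          (E.card : ℝ) ≤ C₀ * (Fintype.card F : ℝ) ^ ((m : ℝ) - 1) ∧
          ∀ (H : Fin L' → MvPolynomial (Fin (m + 1)) F), (∀ l, (H l).totalDegree ≤ D) →
          ∀ (T A : Finset (Fin m → F)),
            (∀ w, w ∈ T ↔ ∀ l, ∃ t : F, MvPolynomial.eval (Fin.snoc w t : Fin (m + 1) → F) (G l) = 0) →
            (∀ v, v ∈ A ↔ ∀ l, ∃ t : F, MvPolynomial.eval (Fin.snoc v t : Fin (m + 1) → F) (H l) = 0) →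
            K < A.card → ∀ t₀ ∈ T, t₀ ∉ E → ∃ a₀ ∈ A, ∃ a ∈ A, a ≠ a₀ ∧ t₀ + a - a₀ ∈ T) := by
  intro m L L' D
  obtain ⟨D', Q₁, C₀, hR⟩ := stub_radicalNormalForm m L D
  obtain ⟨K, Q₂, hP⟩ := stub_persistence m L L' (max D D')
  refine ⟨K, max Q₁ Q₂, C₀, ?_⟩
  intro F _ _ hQ G hG
  -- one-variable forms of the `G l`
  set G' : Fin L → Polynomial (MvPolynomial (Fin m) F) := fun l =>
    MvPolynomial.finSuccEquiv F m (MvPolynomial.rename (finRotate (m + 1)) (G l)) with hG'def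
  have hG' : ∀ l, (G' l).natDegree ≤ D ∧ ∀ k, ((G' l).coeff k).totalDegree ≤ D := fun l =>
    ⟨(Glue.natDegree_toPoly_le m (G l)).trans (hG l),
      fun k => (Glue.totalDegree_coeff_toPoly_le m (G l) k).trans (hG l)⟩
  obtain ⟨S, hSdeg, hSiff, E, hE, hsimple⟩ := hR F (le_trans (le_max_left _ _) hQ) G' hG'
  refine ⟨E, hE, ?_⟩
  intro H hH T A hT hA hK t₀ ht₀ ht₀E
  set H' : Fin L' → Polynomial (MvPolynomial (Fin m) F) := fun l =>
    MvPolynomial.finSuccEquiv F m (MvPolynomial.rename (finRotate (m + 1)) (H l)) with hH'def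
  have hH' : ∀ l, (H' l).natDegree ≤ max D D' ∧ ∀ k, ((H' l).coeff k).totalDegree ≤ max D D' := fun l =>
    ⟨((Glue.natDegree_toPoly_le m (H l)).trans (hH l)).trans (le_max_left _ _),
      fun k => ((Glue.totalDegree_coeff_toPoly_le m (H l) k).trans (hH l)).trans (le_max_left _ _)⟩
  have hT' : ∀ w, w ∈ T ↔ ∀ l, ∃ t : F,
      Polynomial.eval t (Polynomial.map (MvPolynomial.eval w) (S l)) = 0 := by
    intro w
    rw [hT w]
    refine forall_congr' fun l => Iff.trans ?_ (hSiff l w)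
    simp only [hG'def, Glue.eval_snoc_eq]
  have hA' : ∀ v, v ∈ A ↔ ∀ l, ∃ t : F,
      Polynomial.eval t (Polynomial.map (MvPolynomial.eval v) (H' l)) = 0 := by
    intro v
    rw [hA v]
    simp only [hH'def, Glue.eval_snoc_eq]
  have hSdeg' : ∀ l, (S l).natDegree ≤ max D D' ∧ ∀ k, ((S l).coeff k).totalDegree ≤ max D D' :=
    fun l => ⟨(hSdeg l).1.trans (le_max_right _ _), fun k => ((hSdeg l).2 k).trans (le_max_right _ _)⟩
  refine hP F (le_trans (le_max_right _ _) hQ) S hSdeg' H' hH' T A hT' hA' hK t₀ ht₀ fun l => ?_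
  obtain ⟨t, ht⟩ := (hT' t₀).1 ht₀ l
  exact ⟨t, ht, hsimple t₀ ht₀E l t ht⟩

/-- **`HexagonClearanceR` from the persistence stub and CDM 1992 Prop. (2.7).**  The landed chain gives the
uniform mass bound `Σ_I (abc)^{(2+ε)/3} ≤ K·|F|^m` for `ε ≤ 1/(m+1)` in characteristic `≥ q₁`; the crux then
holds vacuously: take `ε₀ := 1/(m+1)` and, given `η > 0`, a characteristic threshold `≥ (max K 1 + 1)^{1/η}`,
so that `|F|^{m+η} ≤ mass ≤ K |F|^m < |F|^{m+η}` is absurd.  Hypotheses: the registered stub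
`stub_persistence` (persistence at a simple root — the open algebraic-geometric core of the line) and the
registered stub `stub_prop27`, which is the tree's named fact
`Literature.ModelTheory.PseudofiniteFields.ChatzidakisVanDenDriesMacintyre1992_prop27`. -/
theorem HexagonClearanceR_of
    (stub_persistence : (∀ (m L L' D : ℕ), ∃ (K Q : ℕ), ∀ (F : Type) [Field F] [Fintype F],
        Q ≤ ringChar F → ∀ (G : Fin L → Polynomial (MvPolynomial (Fin m) F)),
          (∀ l, (G l).natDegree ≤ D ∧ ∀ k, ((G l).coeff k).totalDegree ≤ D) →
          ∀ (H : Fin L' → Polynomial (MvPolynomial (Fin m) F)),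
          (∀ l, (H l).natDegree ≤ D ∧ ∀ k, ((H l).coeff k).totalDegree ≤ D) →
          ∀ (T A : Finset (Fin m → F)),
            (∀ w, w ∈ T ↔ ∀ l, ∃ t : F, Polynomial.eval t (Polynomial.map (MvPolynomial.eval w) (G l)) = 0) →
            (∀ v, v ∈ A ↔ ∀ l, ∃ t : F, Polynomial.eval t (Polynomial.map (MvPolynomial.eval v) (H l)) = 0) →
            K < A.card → ∀ t₀ ∈ T,
              (∀ l, ∃ t : F, Polynomial.eval t (Polynomial.map (MvPolynomial.eval t₀) (G l)) = 0 ∧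
                Polynomial.eval t (Polynomial.derivative (Polynomial.map (MvPolynomial.eval t₀) (G l))) ≠ 0) →
              ∃ a₀ ∈ A, ∃ a ∈ A, a ≠ a₀ ∧ t₀ + a - a₀ ∈ T))
    (stub_prop27 : ChatzidakisVanDenDriesMacintyre1992_prop27) :
    HexagonClearanceR :=
  hexagonClearanceR_of_massBound (stub_massBound_of_shadowBound (stub_shadowBound_of_noLonely
    (stub_noLonely_of_alg (stub_normalForm_of_prop27 stub_prop27) (noLonelyAlg stub_persistence))))

end Summit.MatrixMultiplication.MatrixMultiplication.Theorems.HexagonClearanceR
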